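import Summits.ValiantsHypothesis.ValiantsHypothesis.Theorems.LacunarySymmetroidMatrixDescartesFiniteSectorDefs
import Summits.ValiantsHypothesis.ValiantsHypothesis.Theorems.LacunarySymmetroidMatrixDescartesLocalMultiplicity

/-!
# `MatrixDescartes` — line «finite» / «stamp»: the FIRST ROW of both finite-sector tables, EXACT for EVERY `K`
# (`m = 1`: `ν(1,K) = K − 1`, `η(1,K) = 2K − 1`, by Descartes' rule of signs)

HONEST FRAMING.  Object-search cell `pub-symmetroid`, seat val-sym-eng-3 g10.  HELPER of the crux item `stmt-ValiantsHypothesis-18050`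
(`Theses.LacunarySymmetroid.MatrixDescartes`, asymptotic in `K`) with NO closure claim.  The cell's kernel tables (`…FiniteSectorKernelTable`,
`…KernelTableTwo`, the columns `K = 3, 4, …`) start at size `m = 2`; this file supplies the degenerate first row for ALL `K` at once, where a
`1 × 1` «pencil» `∑_l t^{d_l} s_l` is a real `K`-nomial and everything is Descartes' rule of signs (Mathlib
`Polynomial.roots_countP_pos_le_signVariations`) plus the tree's bound «sign variations ≤ number of terms − 1»
(`LocalMultiplicity.signVariations_le_card_support_sub_one`, `LocalMultiplicity.card_support_sum_C_mul_X_pow_le`, reused, not restated).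
The census-currency twin `ζ(1,K) = K − 1` is the tree's `Census.row_one` (`…CensusClassicalRows`); here are the STAMP and SECTOR currencies:

* `stampLawAt_one_row (K) : StampLawAt 1 K (K - 1)` and `not_stampLawAt_one_row (K ≥ 2) : ¬ StampLawAt 1 K (K - 2)` — **`ν(1,K) = K − 1`**
  (a `K`-nomial has `≤ K − 1` positive zeros; `∏_{i<K-1} (t − (i+1))` has `K − 1` and `K` terms);
* `hypRootLawAt_one_row (K) : HypRootLawAt 1 K (2 * K - 1)` and `not_hypRootLawAt_one_row (K ≥ 1) : ¬ HypRootLawAt 1 K (2 * K - 2)` —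
  **`η(1,K) = 2K − 1`** (`≤ K − 1` positive, `≤ K − 1` negative zeros and possibly `0`; `t · ∏_{i<K-1} (t² − (i+1)²)` has `2K − 1` distinct real
  zeros and `K` terms).

So the first row is the one place where the doubling dictionary is NOT sharp: `η(1,K) = 2ν(1,K) + 1` (the zero root lies in the sector but is not a
stamp).  Nothing here bears on the crux or on `VP ≠ VNP`.
[folklore] Descartes' rule of signs; no citation is load-bearing.
-/

-- `Summit.ValiantsHypothesis.ValiantsHypothesis.…` repeats a component by the D-0017 layout
-- (single-conjunct summit), which the `dupNamespace` linter flags; the name is mandated.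
set_option linter.dupNamespace false

namespace Summit.ValiantsHypothesis.ValiantsHypothesis.Theorems.LacunarySymmetroidMatrixDescartes.FiniteSector

open scoped BigOperators Matrix
open Polynomial Finset

/-! ## §1 Descartes bookkeeping: sign variations ≤ number of terms − 1; fewnomial root counts -/

/-- **Descartes, distinct form.**  A nonzero real polynomial has at most `#support − 1` distinct positive roots. [folklore] -/
theorem card_posRoots_le_card_support_sub_one (P : ℝ[X]) :
    (P.roots.toFinset.filter (fun t => 0 < t)).card ≤ P.support.card - 1 := by
  calc (P.roots.toFinset.filter (fun t => 0 < t)).card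
      = (P.roots.filter (fun t => 0 < t)).toFinset.card := by rw [Multiset.toFinset_filter]
    _ ≤ Multiset.card (P.roots.filter (fun t => 0 < t)) := Multiset.toFinset_card_le _
    _ = P.roots.countP (fun t => 0 < t) := (Multiset.countP_eq_card_filter _ _).symm
    _ ≤ P.signVariations := P.roots_countP_pos_le_signVariations
    _ ≤ P.support.card - 1 := LocalMultiplicity.signVariations_le_card_support_sub_one P

/-- **A real `K`-nomial has at most `K − 1` distinct positive roots.** [folklore] -/
theorem card_posRoots_fewnomial_le {K : ℕ} (d : Fin K → ℕ) (s : Fin K → ℝ) :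
    ((∑ l, C (s l) * X ^ d l).roots.toFinset.filter (fun t => 0 < t)).card ≤ K - 1 :=
  (card_posRoots_le_card_support_sub_one _).trans
    (Nat.sub_le_sub_right (LocalMultiplicity.card_support_sum_C_mul_X_pow_le s d) 1)

/-- Reflecting a `K`-nomial: `(∑_l s_l X^{d_l}) ∘ (−X) = ∑_l (s_l (−1)^{d_l}) X^{d_l}`. [folklore] -/
theorem fewnomial_comp_neg_X {K : ℕ} (d : Fin K → ℕ) (s : Fin K → ℝ) :
    (∑ l, C (s l) * X ^ d l).comp (-X) = ∑ l, C (s l * (-1) ^ d l) * X ^ d l := by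
  rw [Polynomial.sum_comp]
  refine Finset.sum_congr rfl fun l _ => ?_
  rw [Polynomial.mul_comp, Polynomial.C_comp, Polynomial.X_pow_comp, neg_pow, map_mul, map_pow, map_neg, map_one]
  ring

/-- **A real `K`-nomial has at most `K − 1` distinct negative roots** (Descartes for `P(−X)`). [folklore] -/
theorem card_negRoots_fewnomial_le {K : ℕ} (d : Fin K → ℕ) (s : Fin K → ℝ) :
    ((∑ l, C (s l) * X ^ d l).roots.toFinset.filter (fun t => t < 0)).card ≤ K - 1 := by
  classical
  set P : ℝ[X] := ∑ l, C (s l) * X ^ d l with hP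
  have hQ := card_posRoots_fewnomial_le d (fun l => s l * (-1) ^ d l)
  rw [← fewnomial_comp_neg_X d s, Polynomial.roots_comp_neg_X] at hQ
  refine le_trans ?_ hQ
  -- `t ↦ −t` maps the distinct negative roots of `P` injectively into the distinct positive roots of `P(−X)`
  refine Finset.card_le_card_of_injOn (fun t => -t) (fun t ht => ?_) (fun a _ b _ h => neg_injective h)
  rw [Finset.mem_coe, Finset.mem_filter, Multiset.mem_toFinset] at ht
  rw [Finset.mem_coe, Finset.mem_filter, Multiset.mem_toFinset, Multiset.mem_map]
  exact ⟨⟨t, ht.1, rfl⟩, by linarith [ht.2]⟩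

/-- **A nonzero real `K`-nomial has at most `2K − 1` distinct real roots** (`≤ K − 1` positive, `≤ K − 1` negative, possibly `0`). [folklore] -/
theorem card_roots_fewnomial_le {K : ℕ} (hK : 1 ≤ K) (d : Fin K → ℕ) (s : Fin K → ℝ) :
    (∑ l, C (s l) * X ^ d l).roots.toFinset.card ≤ 2 * K - 1 := by
  classical
  set P : ℝ[X] := ∑ l, C (s l) * X ^ d l with hP
  have hsplit : P.roots.toFinset ⊆
      (P.roots.toFinset.filter (fun t => 0 < t)) ∪ (P.roots.toFinset.filter (fun t => t < 0)) ∪ {0} := by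
    intro t ht
    rcases lt_trichotomy t 0 with h | h | h
    · exact Finset.mem_union.2 (Or.inl (Finset.mem_union.2 (Or.inr (Finset.mem_filter.2 ⟨ht, h⟩))))
    · subst h; simp
    · exact Finset.mem_union.2 (Or.inl (Finset.mem_union.2 (Or.inl (Finset.mem_filter.2 ⟨ht, h⟩))))
  have h1 := card_posRoots_fewnomial_le d s
  have h2 := card_negRoots_fewnomial_le d s
  calc P.roots.toFinset.card
      ≤ ((P.roots.toFinset.filter (fun t => 0 < t)) ∪ (P.roots.toFinset.filter (fun t => t < 0)) ∪ {0}).card :=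
        Finset.card_le_card hsplit
    _ ≤ ((P.roots.toFinset.filter (fun t => 0 < t)) ∪ (P.roots.toFinset.filter (fun t => t < 0))).card + 1 :=
        (Finset.card_union_le _ _).trans (by simp)
    _ ≤ (P.roots.toFinset.filter (fun t => 0 < t)).card + (P.roots.toFinset.filter (fun t => t < 0)).card + 1 :=
        Nat.add_le_add_right (Finset.card_union_le _ _) 1
    _ ≤ (K - 1) + (K - 1) + 1 := by gcongr
    _ = 2 * K - 1 := by omega

/-! ## §2 The `1 × 1` pencil is a `K`-nomial -/

/-- The determinant of a `1 × 1` lacunary pencil is the `K`-nomial `∑_l s_l X^{d_l}` with `s_l = S_l 0 0`. [folklore] -/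
theorem det_pencil_one {K : ℕ} (d : Fin K → ℕ) (S : Fin K → Matrix (Fin 1) (Fin 1) ℝ) :
    (pencil d S).det = ∑ l, C (S l 0 0) * X ^ d l := by
  rw [Matrix.det_fin_one]
  unfold pencil
  rw [Matrix.sum_apply]
  refine Finset.sum_congr rfl fun l _ => ?_
  rw [Matrix.smul_apply, Matrix.map_apply, smul_eq_mul, mul_comm]

/-! ## §3 The first row of the stamp table: `ν(1,K) = K − 1` -/

/-- **`ν(1,K) ≤ K − 1`** for every `K`: `StampLawAt 1 K (K − 1)` (a full-positive-rooted `K`-nomial has degree `= #positive zeros ≤ K − 1`).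
[folklore] -/
theorem stampLawAt_one_row (K : ℕ) : StampLawAt 1 K (K - 1) := by
  intro d S _ hfull
  unfold IsFullPosRooted at hfull
  rw [← hfull, Multiset.toFinset_filter, det_pencil_one]
  exact card_posRoots_fewnomial_le d _

/-- **`ν(1,K) ≥ K − 1`**: the `K`-nomial `∏_{i<K-1} (X − (i+1))` (all `K` coefficients present as letters, exponents `0, …, K−1`)
realises `FullyRealisable 1 (l ↦ l) (K − 1)`. [folklore] -/
theorem fullyRealisable_one_row (K : ℕ) (hK : 1 ≤ K) :
    FullyRealisable 1 (fun l : Fin K => (l : ℕ)) (K - 1) := by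
  classical
  -- the positive nodes `1, …, K − 1` as a finset of reals, and the witness polynomial
  set nodes : Finset ℝ := (Finset.range (K - 1)).image (fun i : ℕ => (i : ℝ) + 1) with hnodes
  have hcard : nodes.card = K - 1 := by
    rw [hnodes, Finset.card_image_of_injective _ (fun a b h => by exact_mod_cast add_right_cancel h),
      Finset.card_range]
  have hpos : ∀ x ∈ nodes, (0 : ℝ) < x := by
    intro x hx
    obtain ⟨i, _, rfl⟩ := Finset.mem_image.1 hx
    positivity
  set p : ℝ[X] := ∏ a ∈ nodes, (X - C a) with hp
  have hpdeg : p.natDegree = K - 1 := by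
    rw [hp, natDegree_finsetProd_X_sub_C_eq_card, hcard]
  have hpsum : p = ∑ l : Fin K, C (p.coeff l) * X ^ (l : ℕ) := by
    conv_lhs => rw [p.as_sum_range_C_mul_X_pow, hpdeg]
    rw [show K - 1 + 1 = K by omega]
    exact (Fin.sum_univ_eq_sum_range (fun i => C (p.coeff i) * X ^ i) K).symm
  have hdet : (pencil (fun l : Fin K => (l : ℕ)) (fun l => Matrix.of fun (_ : Fin 1) (_ : Fin 1) => p.coeff l)).det
      = p := by
    rw [det_pencil_one]
    simp only [Matrix.of_apply]
    exact hpsum.symm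
  refine ⟨fun l => Matrix.of fun _ _ => p.coeff l, fun l => ?_, ?_, ?_⟩
  · ext i j
    fin_cases i; fin_cases j; rfl
  · unfold IsFullPosRooted
    rw [hdet, hpdeg, hp, Polynomial.roots_prod_X_sub_C, Multiset.filter_eq_self.2 (fun x hx => hpos x hx),
      Finset.val_toFinset, hcard]
  · rw [hdet, hpdeg]

/-- **`ν(1,K) = K − 1` is sharp**: `¬ StampLawAt 1 K (K − 2)` for `K ≥ 2`. [folklore] -/
theorem not_stampLawAt_one_row (K : ℕ) (hK : 2 ≤ K) : ¬ StampLawAt 1 K (K - 2) := by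
  intro h
  obtain ⟨S, hS, hfull, hdeg⟩ := fullyRealisable_one_row K (by omega)
  have := h _ S hS hfull
  omega

/-- **First row of the stamp table, EXACT for every `K ≥ 2`: `ν(1,K) = K − 1`.** [folklore] -/
theorem nu_one_row_exact (K : ℕ) (hK : 2 ≤ K) : StampLawAt 1 K (K - 1) ∧ ¬ StampLawAt 1 K (K - 2) :=
  ⟨stampLawAt_one_row K, not_stampLawAt_one_row K hK⟩

/-! ## §4 The first row of the sector table: `η(1,K) = 2K − 1` -/

/-- **`η(1,K) ≤ 2K − 1`** for every `K ≥ 1`: `HypRootLawAt 1 K (2K − 1)` (an in-sector `K`-nomial has degree `= #distinct real zeros ≤ 2K − 1`).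
[folklore] -/
theorem hypRootLawAt_one_row (K : ℕ) (hK : 1 ≤ K) : HypRootLawAt 1 K (2 * K - 1) := by
  intro d S _ hsec
  unfold IsRealRootedSimple at hsec
  rw [← hsec, det_pencil_one]
  exact card_roots_fewnomial_le hK d _

/-- Splitting a sum over `range (2K)` into even and odd indices. [folklore] -/
theorem sum_range_two_mul {M : Type*} [AddCommMonoid M] (f : ℕ → M) (K : ℕ) :
    ∑ n ∈ Finset.range (2 * K), f n = ∑ l ∈ Finset.range K, (f (2 * l) + f (2 * l + 1)) := by
  induction K with
  | zero => simp
  | succ K ih =>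
    rw [show 2 * (K + 1) = 2 * K + 1 + 1 by ring, Finset.sum_range_succ, Finset.sum_range_succ, ih,
      Finset.sum_range_succ, add_assoc]

/-- **`η(1,K) ≥ 2K − 1`**: the odd `K`-nomial `X · ∏_{i<K-1} (X² − (i+1)²)` (exponents `1, 3, …, 2K − 1`) has the `2K − 1` distinct real
zeros `0, ±1, …, ±(K−1)`, so `¬ HypRootLawAt 1 K (2K − 2)` for `K ≥ 1`. [folklore] -/
theorem not_hypRootLawAt_one_row (K : ℕ) (hK : 1 ≤ K) : ¬ HypRootLawAt 1 K (2 * K - 2) := by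
  classical
  intro hlaw
  set nodes : Finset ℝ := (Finset.range (K - 1)).image (fun i : ℕ => (i : ℝ) + 1) with hnodes
  have hcard : nodes.card = K - 1 := by
    rw [hnodes, Finset.card_image_of_injective _ (fun a b h => by exact_mod_cast add_right_cancel h),
      Finset.card_range]
  have hpos : ∀ x ∈ nodes, (0 : ℝ) < x := by
    intro x hx
    obtain ⟨i, _, rfl⟩ := Finset.mem_image.1 hx
    positivity
  -- `r(Y) = ∏ (Y − a²)` and the witness `q = X · r(X²) = X ∏ (X − a)(X + a)`
  set r : ℝ[X] := ∏ a ∈ nodes, (X - C (a ^ 2)) with hr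
  have hrdeg : r.natDegree = K - 1 := by
    rw [hr, natDegree_finsetProd_X_sub_C_eq_card, hcard]
  set q : ℝ[X] := X * ∏ a ∈ nodes, ((X - C a) * (X + C a)) with hq
  -- fewnomial form of `q`: exponents `2l + 1`, letters `coeff r l`
  have hrsum : r = ∑ l : Fin K, C (r.coeff l) * X ^ (l : ℕ) := by
    conv_lhs => rw [r.as_sum_range_C_mul_X_pow, hrdeg]
    rw [show K - 1 + 1 = K by omega]
    exact (Fin.sum_univ_eq_sum_range (fun i => C (r.coeff i) * X ^ i) K).symm
  have hrcomp : r.comp (X ^ 2) = ∏ a ∈ nodes, ((X - C a) * (X + C a)) := by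
    rw [hr, Polynomial.prod_comp]
    refine Finset.prod_congr rfl fun a _ => ?_
    rw [Polynomial.sub_comp, Polynomial.X_comp, Polynomial.C_comp, map_pow]
    ring
  have hqsum : q = ∑ l : Fin K, C (r.coeff l) * X ^ (2 * (l : ℕ) + 1) := by
    rw [hq, ← hrcomp]
    conv_lhs => rw [hrsum]
    rw [Polynomial.sum_comp, Finset.mul_sum]
    refine Finset.sum_congr rfl fun l _ => ?_
    rw [Polynomial.mul_comp, Polynomial.C_comp, Polynomial.X_pow_comp, ← pow_mul, pow_succ, mul_comm 2]
    ring
  have hdet : (pencil (fun l : Fin K => 2 * (l : ℕ) + 1) (fun l => Matrix.of fun (_ : Fin 1) (_ : Fin 1) => r.coeff l)).det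
      = q := by
    rw [det_pencil_one]
    simp only [Matrix.of_apply]
    exact hqsum.symm
  -- degree of `q`
  have hmon : ∀ a ∈ nodes, ((X - C a) * (X + C a)).Monic := fun a _ => (monic_X_sub_C a).mul (monic_X_add_C a)
  have hqdeg : q.natDegree = 2 * K - 1 := by
    have hprod : (∏ a ∈ nodes, ((X - C a) * (X + C a))).Monic := Polynomial.monic_prod_of_monic _ _ hmon
    rw [hq, (Polynomial.monic_X).natDegree_mul hprod, natDegree_X, Polynomial.natDegree_prod_of_monic _ _ hmon]
    have : ∀ a ∈ nodes, ((X - C a) * (X + C a)).natDegree = 2 := by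
      intro a _
      rw [(monic_X_sub_C a).natDegree_mul (monic_X_add_C a), natDegree_X_sub_C, natDegree_X_add_C]
    rw [Finset.sum_congr rfl this, Finset.sum_const, hcard, smul_eq_mul]
    omega
  -- `2K − 1` distinct real zeros: `0`, the nodes, and their negatives
  have hq0 : q ≠ 0 := by
    intro h; have := congrArg Polynomial.natDegree h; rw [hqdeg, natDegree_zero] at this; omega
  set T : Finset ℝ := insert 0 (nodes ∪ nodes.image (fun a => -a)) with hT
  have hTcard : T.card = 2 * K - 1 := by
    rw [hT, Finset.card_insert_of_notMem, Finset.card_union_of_disjoint, Finset.card_image_of_injective _ neg_injective,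
      hcard]
    · omega
    · exact Finset.disjoint_left.2 fun x hx hx' => by
        obtain ⟨y, hy, rfl⟩ := Finset.mem_image.1 hx'
        linarith [hpos _ hx, hpos y hy]
    · intro h0
      rcases Finset.mem_union.1 h0 with h0 | h0
      · exact lt_irrefl _ (hpos 0 h0)
      · obtain ⟨y, hy, hy0⟩ := Finset.mem_image.1 h0
        linarith [hpos y hy]
  have hTroots : T ⊆ q.roots.toFinset := by
    intro x hx
    rw [Multiset.mem_toFinset, Polynomial.mem_roots hq0, Polynomial.IsRoot.def, hq, Polynomial.eval_mul,
      Polynomial.eval_X, Polynomial.eval_prod]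
    rw [hT] at hx
    rcases Finset.mem_insert.1 hx with h0 | hx'
    · rw [h0]; simp
    · rcases Finset.mem_union.1 hx' with hxn | hxi
      · rw [Finset.prod_eq_zero hxn (by simp)]; ring
      · obtain ⟨y, hy, hyx⟩ := Finset.mem_image.1 hxi
        rw [← hyx, Finset.prod_eq_zero hy (by simp)]; ring
  have hsec : IsRealRootedSimple q := by
    unfold IsRealRootedSimple
    refine le_antisymm ((Multiset.toFinset_card_le _).trans (Polynomial.card_roots' q)) ?_
    rw [hqdeg, ← hTcard]
    exact Finset.card_le_card hTroots
  -- apply the law to the `1 × 1` pencil with letters `coeff r l` on exponents `2l + 1`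
  have hsym : ∀ l : Fin K, (Matrix.of fun (_ : Fin 1) (_ : Fin 1) => r.coeff l).IsSymm := fun l => by
    ext i j; fin_cases i; fin_cases j; rfl
  have := hlaw (fun l : Fin K => 2 * (l : ℕ) + 1) (fun l => Matrix.of fun (_ : Fin 1) (_ : Fin 1) => r.coeff l) hsym
    (by rw [hdet]; exact hsec)
  rw [hdet, hqdeg] at this
  omega

/-- **First row of the sector table, EXACT for every `K ≥ 1`: `η(1,K) = 2K − 1`** — the one row where doubling is not sharp
(`η(1,K) = 2·ν(1,K) + 1`: the zero root is in the sector but is not a stamp). [folklore] -/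
theorem eta_one_row_exact (K : ℕ) (hK : 1 ≤ K) : HypRootLawAt 1 K (2 * K - 1) ∧ ¬ HypRootLawAt 1 K (2 * K - 2) :=
  ⟨hypRootLawAt_one_row K hK, not_hypRootLawAt_one_row K hK⟩

end Summit.ValiantsHypothesis.ValiantsHypothesis.Theorems.LacunarySymmetroidMatrixDescartes.FiniteSector
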